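import Mathlib
import Summits.ValiantsHypothesis.ValiantsHypothesis.Theorems.MonotoneRestorationOrbitRestorationQPLevelMatch
import Summits.ValiantsHypothesis.ValiantsHypothesis.Theorems.MonotoneRestorationOrbitRestorationQPProductAction
import Summits.ValiantsHypothesis.ValiantsHypothesis.Theorems.MonotoneRestorationOrbitRestorationQPStableForms
import HarnessLib

/-!
# Structure of symmetric `ΣΠΣ(k)` circuits, 0: the matrix action permutes the cluster sums; even rows and columns fix them (ORBIT currency)

Route MonotoneRestoration, crux `OrbitRestorationQP` (stmt-ValiantsHypothesis-18293), line `depth-three-rung`, registered stub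
`stub_sigmaPiSigmaKValue` (A_k).  Namespace `Summit.ValiantsHypothesis.ValiantsHypothesis.Theorems.LevelStructure`.  Route-independent.

Layer L5 (b) of the formalisation plan of `Cruxes/OrbitRestorationQP/Lines/depth-three-rung-stubA-bounded-fanin.md` (§2 (c)–(e)), at
ONE level `n`, for a matrix-symmetric `f` (invariant under independent row and column permutations, the action `mact σ τ`) with a
clean minimal representation `R` (`…LevelRep.lean`) and a good labelling `cl` of its terms:

* `perm_clusterSum` — every `mact σ τ` permutes the cluster sums `F_a` (matching lemma);
* `rowFix_clusterSum` / `colFix_clusterSum` — EVEN row and column permutations fix every cluster sum (`< n` images; Dixon–Mortimer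
  with `k = 1`, `…ProductAction.altFix_of_ncard_lt`);
(The small-subalgebra / essential-space half is `…LevelStructureA.lean`.)

Everything is proved modulo the named fact `depthThree_rankBound`, taken BY NAME as a hypothesis. [cite: KarninShpilka2009, §3;
SaxenaSeshadhri2013, Theorem 5; DixonMortimer1996, Thm 5.2B]
-/

noncomputable section

open MvPolynomial Equiv Literature.Computability.AlgebraicComplexity

-- `Summit.ValiantsHypothesis.ValiantsHypothesis.…` is the tree's single-conjunct layout (Sub = Summit).
set_option linter.dupNamespace false

namespace Summit.ValiantsHypothesis.ValiantsHypothesis.Theorems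

namespace LevelStructure

open RankDistance LinNL LinearSubalgebra ProductAction LevelRep

variable {n : ℕ}

local notation "P2" => MvPolynomial (Fin n × Fin n) ℂ

/-! ### The matrix action -/

/-- The matrix action `(σ, τ) ↦ (x_{p q} ↦ x_{σ p, τ q})` as an algebra automorphism. [folklore] -/
def mact (σ τ : Perm (Fin n)) : MvPolynomial (Fin n × Fin n) ℂ ≃ₐ[ℂ] MvPolynomial (Fin n × Fin n) ℂ :=
  (vact (K := ℂ) colHom τ).trans (vact (K := ℂ) rowHom σ)

/-- `mact σ τ` is the independent renaming of rows and columns. [folklore] -/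
theorem mact_apply (σ τ : Perm (Fin n)) (f : MvPolynomial (Fin n × Fin n) ℂ) :
    mact σ τ f = rename (fun p : Fin n × Fin n => (σ p.1, τ p.2)) f := by
  rw [mact, AlgEquiv.trans_apply, rename_prod_eq]

/-- Renaming by an equivalence preserves the total degree. [folklore] -/
theorem totalDegree_rename_equiv {V : Type} (e : V ≃ V) (q : MvPolynomial V ℂ) : (rename e q).totalDegree = q.totalDegree := by
  refine le_antisymm (totalDegree_rename_le _ _) ?_
  conv_lhs => rw [show q = rename e.symm (rename e q) by rw [rename_rename]; simp]
  exact totalDegree_rename_le _ _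

/-- `mact σ τ` preserves total degrees. [folklore] -/
theorem totalDegree_mact (σ τ : Perm (Fin n)) (q : MvPolynomial (Fin n × Fin n) ℂ) :
    (mact σ τ q).totalDegree = q.totalDegree := by
  rw [mact_apply]
  exact totalDegree_rename_equiv (Equiv.prodCongr σ τ) q

/-- `vact rowHom σ = mact σ 1` and `vact colHom τ = mact 1 τ`. [folklore] -/
theorem vact_rowHom_eq (σ : Perm (Fin n)) (f : MvPolynomial (Fin n × Fin n) ℂ) : vact (K := ℂ) rowHom σ f = mact σ 1 f := by
  rw [mact, AlgEquiv.trans_apply, map_one, AlgEquiv.one_apply]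

/-- `vact colHom τ = mact 1 τ`. [folklore] -/
theorem vact_colHom_eq (τ : Perm (Fin n)) (f : MvPolynomial (Fin n × Fin n) ℂ) : vact (K := ℂ) colHom τ f = mact 1 τ f := by
  rw [mact, AlgEquiv.trans_apply, map_one, AlgEquiv.one_apply]

/-- The diagonal action is `mact ρ ρ`. [folklore] -/
theorem ren_eq_mact (ρ : Perm (Fin n)) (f : MvPolynomial (Fin n × Fin n) ℂ) : ren ρ f = mact ρ ρ f := by
  rw [ren_eq_row_col, mact, AlgEquiv.trans_apply]

/-- The invariant linear form `U = Σ_{p,q} x_{p q}`. [folklore] -/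
def U (n : ℕ) : MvPolynomial (Fin n × Fin n) ℂ := ∑ P : Fin n × Fin n, X P

/-- `U` is fixed by the matrix action. [folklore] -/
theorem mact_U (σ τ : Perm (Fin n)) : mact σ τ (U n) = U n := by
  rw [mact_apply, U, map_sum]
  simp only [rename_X]
  exact Fintype.sum_equiv (Equiv.prodCongr σ τ) _ _ fun P => rfl

/-! ### The setting: a matrix-symmetric polynomial with a clean representation and a good labelling -/

/-- The standing data at one level: a matrix-symmetric `f`, a clean minimal representation, a good labelling of its terms for the
rank distance, and the numerical side conditions. [folklore] -/
structure Setting (n D : ℕ) where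
  /-- the polynomial -/
  f : MvPolynomial (Fin n × Fin n) ℂ
  hsym : ∀ σ τ : Perm (Fin n), mact σ τ f = f
  /-- its clean representation -/
  R : CleanRep f D
  /-- the labelling and its diameter -/
  cl : Fin R.m → Fin R.m
  Θ : ℕ
  hdiam : ∀ i j, cl i = cl j → rdist (R.L i) (R.L j) ≤ Θ
  hsep : ∀ i j, cl i ≠ cl j → 2 * Rb R.m D + Θ < rdist (R.L i) (R.L j)
  hn8 : 8 < n
  hmn : R.m < n

namespace Setting

variable {D : ℕ} (S : Setting n D)

/-- The cluster sum of label `a`. [folklore] -/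
def F (a : Fin S.R.m) : MvPolynomial (Fin n × Fin n) ℂ := S.R.clusterSum S.cl a

/-- The labels with nonempty fibre. [folklore] -/
def labs : Finset (Fin S.R.m) := Finset.univ.image S.cl

/-- The fibre of a label. [folklore] -/
def fibre (a : Fin S.R.m) : Finset (Fin S.R.m) := Finset.univ.filter fun i => S.cl i = a

/-- Labels in `labs` have nonempty fibre. [folklore] -/
theorem fibre_nonempty {a : Fin S.R.m} (ha : a ∈ S.labs) : (S.fibre a).Nonempty := by
  obtain ⟨i, -, hi⟩ := Finset.mem_image.1 ha
  exact ⟨i, by simp [fibre, hi]⟩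

/-- Cluster sums of labels in `labs` are nonzero. [folklore] -/
theorem F_ne_zero {a : Fin S.R.m} (ha : a ∈ S.labs) : S.F a ≠ 0 := by
  obtain ⟨i, -, hi⟩ := Finset.mem_image.1 ha
  exact S.R.clusterSum_ne_zero S.cl ⟨i, hi⟩

/-- A label with nonzero cluster sum is in `labs`. [folklore] -/
theorem mem_labs_of_F_ne_zero {a : Fin S.R.m} (ha : S.F a ≠ 0) : a ∈ S.labs := by
  by_contra h
  refine ha (S.R.clusterSum_eq_zero S.cl fun ⟨i, hi⟩ => h ?_)
  exact Finset.mem_image.2 ⟨i, Finset.mem_univ i, hi⟩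

/-- `f = Σ_{a ∈ labs} F a`. [folklore] -/
theorem sum_F : ∑ a ∈ S.labs, S.F a = S.f := by
  have h := S.R.sum_clusterSum S.cl
  rw [← Finset.sum_subset (Finset.subset_univ S.labs)] at h
  · exact h
  · intro a _ ha
    exact S.R.clusterSum_eq_zero S.cl fun ⟨i, hi⟩ => ha (Finset.mem_image.2 ⟨i, Finset.mem_univ i, hi⟩)

/-! ### The matrix action permutes the cluster sums; even rows and columns fix them -/

/-- **Every `mact σ τ` permutes the cluster sums.** [cite: KarninShpilka2009, §3] -/
theorem perm_clusterSum (hRB : depthThree_rankBound) (σ τ : Perm (Fin n)) :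
    (∀ a, ∃ b, mact σ τ (S.F b) = S.F a) ∧ (∀ b, ∃ a, mact σ τ (S.F b) = S.F a) :=
  match_of_fix hRB S.R S.cl S.Θ S.hdiam S.hsep (mact σ τ) (totalDegree_mact σ τ) (S.hsym σ τ)

/-- The images of a cluster sum under an action through `mact` lie among the cluster sums. [folklore] -/
theorem range_subset (hRB : depthThree_rankBound) (g : Perm (Fin n) → Perm (Fin n) × Perm (Fin n)) (b : Fin S.R.m) :
    (Set.range fun ρ => mact (g ρ).1 (g ρ).2 (S.F b)) ⊆ ↑(Finset.univ.image S.F) := by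
  rintro _ ⟨ρ, rfl⟩
  obtain ⟨a, ha⟩ := (S.perm_clusterSum hRB (g ρ).1 (g ρ).2).2 b
  simp only [Finset.coe_image, Finset.coe_univ, Set.image_univ, Set.mem_range]
  exact ⟨a, ha.symm⟩

/-- **Even row permutations fix every cluster sum** (fewer than `n` images). [cite: DixonMortimer1996, Thm 5.2B] -/
theorem rowFix_clusterSum (hRB : depthThree_rankBound) (a : Fin S.R.m) :
    ∀ ρ : Perm (Fin n), Perm.sign ρ = 1 → vact (K := ℂ) rowHom ρ (S.F a) = S.F a := by
  have hsub := S.range_subset hRB (fun ρ => (ρ, 1)) a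
  have hfin : (Set.range fun ρ : Perm (Fin n) => vact (K := ℂ) rowHom ρ (S.F a)).Finite :=
    (Finset.finite_toSet (Finset.univ.image S.F)).subset (by simpa only [vact_rowHom_eq] using hsub)
  have hlt : (Set.range fun ρ : Perm (Fin n) => vact (K := ℂ) rowHom ρ (S.F a)).ncard < n.choose 1 := by
    rw [Nat.choose_one_right]
    refine lt_of_le_of_lt ?_ S.hmn
    calc (Set.range fun ρ : Perm (Fin n) => vact (K := ℂ) rowHom ρ (S.F a)).ncard
        ≤ (↑(Finset.univ.image S.F) : Set (MvPolynomial (Fin n × Fin n) ℂ)).ncard := by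
          refine Set.ncard_le_ncard ?_ (Finset.finite_toSet _)
          simpa only [vact_rowHom_eq] using hsub
      _ ≤ S.R.m := by
          rw [Set.ncard_coe_finset]
          exact Finset.card_image_le.trans (by simp)
  obtain ⟨Y, hY, hfix⟩ := altFix_of_ncard_lt (vact (K := ℂ) rowHom) S.hn8 le_rfl (by have := S.hn8; omega) (S.F a) hfin hlt
  have hY0 : Y = ∅ := Finset.card_eq_zero.1 (by omega)
  intro ρ hρ
  exact hfix ρ (by simp [hY0]) hρ

/-- **Even column permutations fix every cluster sum.** [cite: DixonMortimer1996, Thm 5.2B] -/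
theorem colFix_clusterSum (hRB : depthThree_rankBound) (a : Fin S.R.m) :
    ∀ ρ : Perm (Fin n), Perm.sign ρ = 1 → vact (K := ℂ) colHom ρ (S.F a) = S.F a := by
  have hsub := S.range_subset hRB (fun ρ => (1, ρ)) a
  have hfin : (Set.range fun ρ : Perm (Fin n) => vact (K := ℂ) colHom ρ (S.F a)).Finite :=
    (Finset.finite_toSet (Finset.univ.image S.F)).subset (by simpa only [vact_colHom_eq] using hsub)
  have hlt : (Set.range fun ρ : Perm (Fin n) => vact (K := ℂ) colHom ρ (S.F a)).ncard < n.choose 1 := by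
    rw [Nat.choose_one_right]
    refine lt_of_le_of_lt ?_ S.hmn
    calc (Set.range fun ρ : Perm (Fin n) => vact (K := ℂ) colHom ρ (S.F a)).ncard
        ≤ (↑(Finset.univ.image S.F) : Set (MvPolynomial (Fin n × Fin n) ℂ)).ncard := by
          refine Set.ncard_le_ncard ?_ (Finset.finite_toSet _)
          simpa only [vact_colHom_eq] using hsub
      _ ≤ S.R.m := by
          rw [Set.ncard_coe_finset]
          exact Finset.card_image_le.trans (by simp)
  obtain ⟨Y, hY, hfix⟩ := altFix_of_ncard_lt (vact (K := ℂ) colHom) S.hn8 le_rfl (by have := S.hn8; omega) (S.F a) hfin hlt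
  have hY0 : Y = ∅ := Finset.card_eq_zero.1 (by omega)
  intro ρ hρ
  exact hfix ρ (by simp [hY0]) hρ

end Setting

end LevelStructure

end Summit.ValiantsHypothesis.ValiantsHypothesis.Theorems

end
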